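import Literature.MathematicalPhysics.QuantumLattice.InfVolFermionStateTorusLimitTwoSectorEnergyEntropyBalance
import HarnessLib

/-!
# The two-sector energy–entropy balance row of a SINGLE ANNIHILATOR `c_{x↑}` for the thermal object of
# record: sector mapping discharged, image sector `(k_L − 1, k_L)`

Topic `Literature/MathematicalPhysics/QuantumLattice`; complement of
`InfVolFermionStateTorusLimitTwoSectorEnergyEntropyBalance.lean` (§3–§4 there: the charged rows for a
PAIR `(ω, ω')` of thermal torus limits and a limit `r` of the canonical partition-function ratio, with the
sector-mapping property of the embedded generator as a hypothesis BY NAME at every side `L`). Two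
additions:

* §1 `InfVolFermionState.re_expect_twoSector_eeb_nonneg_of_canonical_limits_eventually` — the same rows
  with the sector-mapping hypotheses required only EVENTUALLY along `Ls` (the natural form: a generator that
  lowers `N↑` has the right image sector only once `k_L = halfRectN n L ≥ 1`);
* §2–§3 the first template DISCHARGED: for the local annihilator `A = c_{x↑}` (`x ∈ Λ`) the torus embedding
  of `Ã = Γ_{Λ⊆Λ₁}A` is the torus annihilator `c_{x mod L,↑}` (`fermionEmbed_annihilation`), which carries
  the sector `(k, k)` into `(k − 1, k)` and whose adjoint `c†` carries `(k − 1, k)` back into `(k, k)`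
  (`IsInSector.annihilation_up_mulVec`, `IsInSector.creation_up_mulVec`, for `k ≥ 1`); hence
  (`IsTorusLimitOfMixture.re_expect_twoSector_eeb_annihilation_up_nonneg_of_sectorGibbs`) for EVERY torus
  limit `ω` of the canonical `(rectN n L, S^z = 0)` Gibbs states (`0 < n`), every companion torus limit
  `ω'` along the same `Ls` of the canonical states of the sectors `(k_L − 1, k_L)`, and the limit `r` of
  `Z_{(k−1,k)}/Z_{(k,k)}`:
  `0 ≤ β·Re ω_{Λ₁}(c̃†(H_{Λ₁}c̃ − c̃H_{Λ₁})) − s·Re ω_{Λ₁}(c̃†c̃) + q·r·Re ω'_{Λ₁}(c̃c̃†)`, `e^{s−1} ≤ q` — the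
  «rm↑» row of a thermal relaxation for the canonical object, with `e^{βμ}` the canonical one-particle
  removal cost and the hole density read in the companion state. The image sectors are nonempty
  (`k_L − 1, k_L ≤ L²`), so the companion data exist along subsequences by
  `IsTorusLimitOfMixture.exists_twoSector_companion_of_sectorGibbs` once the ratio is bracketed.

HONEST SCOPE: one template (`c_{x↑}`; `c_{x↓}`, pairs and spin flips are the same proof with the other
ladder lemmas of `HubbardSzSectorLadder`); rows for pairs of states, no claim `ω' = ω`. Everything is
PROVED; no definition, no named fact.

## Mathlib / tree search

REUSED: `twoSector_eeb_torusAvgExpectAt_nonneg`, `apply_eq_zero_off_of_mulVec_mem₂`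
(`InfVolFermionStateTorusLimitTwoSectorEnergyEntropyBalance`); `mem_szSector_iff_spinConfig`,
`hubbardTorusTT'_apply_eq_zero_of_spinConfig`, `fockTranslate_apply_eq_zero_of_spinConfig`
(`TorusGibbsTwoSectorEnergyEntropyBalance`); `IsInSector.annihilation_up_mulVec`,
`IsInSector.creation_up_mulVec`, `mem_szSector_iff_isInSector` (`HubbardSzSectorLadder`);
`fermionEmbed_annihilation`, `annihilation_conjTranspose`, `mem_szSector_rectN_iff`,
`hubbardTorusTT'_apply_eq_zero_of_szConfig`, `fockTranslate_apply_eq_zero_of_szConfig`, `sectorGibbsIndex`,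
`torusAvgExpect_eq`, `eventually_injOn_proj_of_tendsto`, Mathlib `Nat.le_floor_iff`, `ge_of_tendsto`.
`lean search 'annihilation.*twoSector|rm.*row'`: nothing (2026-08-27).

## References

* O. Bratteli, D. W. Robinson, *Operator Algebras and Quantum Statistical Mechanics 2* (1997),
  Thm. 5.3.15, §5.4.2. [cite: BratteliRobinsonII1997, §5.4.2]
* H. Fawzi, O. Fawzi, S. O. Scalet (2024), Thm. 3.1, §3.2. [cite: FawziFawziScalet2024, Thm. 3.1]
* E. H. Lieb, Phys. Rev. Lett. 62 (1989) 1201, eq. (2) (`c_{xσ}` between spin sectors).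
  [cite: LiebPRL1989, proof of Theorem 1]
-/

noncomputable section

namespace Literature.MathematicalPhysics.QuantumLattice

open Matrix Finset HubbardWave0 Literature.Probability.LatticeModels ThermodynamicLimit
open _root_.Filter
open scoped _root_.Topology ComplexOrder BigOperators

/-! ### §1 The pair rows with EVENTUAL sector-mapping hypotheses -/

section Eventually

variable (t t' U β : ℝ)

/-- Reindexing a weighted sum of torus averages along an enumeration of the sector. [folklore] -/
private theorem sum_reindex_torusAvg' {L : ℕ} [NeZero L] {P : Finset (Orb (FermionTorus 2 L)) → Prop}
    [DecidablePred P] {m : ℕ} (e : Fin m ≃ Subtype P) (w : Subtype P → ℝ)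
    (φ : Subtype P → Fock (Orb (FermionTorus 2 L))) {p : Fin m → ℝ}
    {ψ : Fin m → Fock (Orb (FermionTorus 2 L))} (hp : ∀ i, p i = w (e i)) (hψ : ∀ i, ψ i = φ (e i))
    {Λ : Finset (Site 2)} (X : FermionOp Λ) :
    ∑ i, (p i : ℂ) * torusAvgExpect L Λ X (ψ i) = ∑ c, (w c : ℂ) * torusAvgExpectAt L Λ X (φ c) := by
  simp_rw [torusAvgExpect_eq, hp, hψ]
  exact Equiv.sum_comp e (fun c => (w c : ℂ) * torusAvgExpectAt L Λ X (φ c))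

/-- **Two-sector rows for a pair of thermal torus limits, sector mapping required only eventually.** As
`InfVolFermionState.re_expect_twoSector_eeb_nonneg_of_canonical_limits`, but the hypotheses that the torus
embedding of `Ã` carries `P_L` into `P'_L` (and its adjoint `P'_L` into `P_L`) are required only for
`L = Ls j` with `j` large. [cite: FawziFawziScalet2024, Thm. 3.1] [cite: BratteliRobinsonII1997, §5.4.2] -/
theorem InfVolFermionState.re_expect_twoSector_eeb_nonneg_of_canonical_limits_eventually
    (P P' : ∀ L : ℕ, Finset (Orb (FermionTorus 2 L)) → Prop)
    [hdP : ∀ L, DecidablePred (P L)] [hdP' : ∀ L, DecidablePred (P' L)]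
    (hP : ∀ L s s', ¬ P L s → P L s' → hubbardTorusTT' L t t' U s s' = 0)
    (hP' : ∀ L s s', ¬ P' L s → P' L s' → hubbardTorusTT' L t t' U s s' = 0)
    (hUP : ∀ (L : ℕ) [NeZero L] (v : TorusSite 2 L) s s', ¬ P L s → P L s' → (fockTranslate v).val s s' = 0)
    (hUP' : ∀ (L : ℕ) [NeZero L] (v : TorusSite 2 L) s s', ¬ P' L s → P' L s' → (fockTranslate v).val s s' = 0)
    {m m' : ℕ → ℕ} {p : ∀ L, Fin (m L) → ℝ} {ψ : ∀ L, Fin (m L) → Fock (Orb (FermionTorus 2 L))}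
    {p' : ∀ L, Fin (m' L) → ℝ} {ψ' : ∀ L, Fin (m' L) → Fock (Orb (FermionTorus 2 L))}
    (e : ∀ L, Fin (m L) ≃ Subtype (P L)) (e' : ∀ L, Fin (m' L) ≃ Subtype (P' L))
    (hp : ∀ L i, p L i = canonicalWeight β (sectorEigenvalue (P L) (hubbardTorusTT' L t t' U)
      (hubbardTorusTT'_isHermitian L t t' U)) (e L i))
    (hψ : ∀ L i, ψ L i = sectorEigenvector (P L) (hubbardTorusTT' L t t' U)
      (hubbardTorusTT'_isHermitian L t t' U) (e L i))
    (hp' : ∀ L i, p' L i = canonicalWeight β (sectorEigenvalue (P' L) (hubbardTorusTT' L t t' U)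
      (hubbardTorusTT'_isHermitian L t t' U)) (e' L i))
    (hψ' : ∀ L i, ψ' L i = sectorEigenvector (P' L) (hubbardTorusTT' L t t' U)
      (hubbardTorusTT'_isHermitian L t t' U) (e' L i))
    {Ls : ℕ → ℕ} (hLs : Tendsto Ls atTop atTop) {ω ω' : InfVolFermionState 2}
    (hω : ω.IsTorusLimitOfMixture m p ψ Ls) (hω' : ω'.IsTorusLimitOfMixture m' p' ψ' Ls)
    {r : ℝ} (hr : Tendsto (fun j =>
      (∑ d, Real.exp (-(β * sectorEigenvalue (P' (Ls j)) (hubbardTorusTT' (Ls j) t t' U)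
          (hubbardTorusTT'_isHermitian (Ls j) t t' U) d))) /
        ∑ c, Real.exp (-(β * sectorEigenvalue (P (Ls j)) (hubbardTorusTT' (Ls j) t t' U)
          (hubbardTorusTT'_isHermitian (Ls j) t t' U) c))) atTop (𝓝 r))
    {Λ : Finset (Site 2)} (A : FermionOp Λ)
    (hB : ∀ᶠ j in atTop, ∀ (hL : NeZero (Ls j)) (h₁ : Set.InjOn (Torus.proj (d := 2) (Ls j)) ↑(thicken Λ 1)) s s',
      ¬ P' (Ls j) s → P (Ls j) s' →
        fermionEmbed (@PolySite.toTorusEmb 2 (Ls j) hL _ h₁)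
          (fermionEmbed (PolySite.incl (subset_thicken Λ 1)) A) s s' = 0)
    (hB' : ∀ᶠ j in atTop, ∀ (hL : NeZero (Ls j)) (h₁ : Set.InjOn (Torus.proj (d := 2) (Ls j)) ↑(thicken Λ 1)) s s',
      ¬ P (Ls j) s → P' (Ls j) s' →
        (fermionEmbed (@PolySite.toTorusEmb 2 (Ls j) hL _ h₁)
          (fermionEmbed (PolySite.incl (subset_thicken Λ 1)) A))ᴴ s s' = 0)
    {s q : ℝ} (hq : Real.exp (s - 1) ≤ q) :
    0 ≤ β * (ω.expect (thicken Λ 1)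
          ((fermionEmbed (PolySite.incl (subset_thicken Λ 1)) A)ᴴ *
            ((hubbardTTPrimeFermionInteraction t t' U).localHamiltonian (thicken Λ 1) *
                fermionEmbed (PolySite.incl (subset_thicken Λ 1)) A -
              fermionEmbed (PolySite.incl (subset_thicken Λ 1)) A *
                (hubbardTTPrimeFermionInteraction t t' U).localHamiltonian (thicken Λ 1)))).re -
        s * (ω.expect (thicken Λ 1)
          ((fermionEmbed (PolySite.incl (subset_thicken Λ 1)) A)ᴴ *
            fermionEmbed (PolySite.incl (subset_thicken Λ 1)) A)).re +
        q * r * (ω'.expect (thicken Λ 1)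
          (fermionEmbed (PolySite.incl (subset_thicken Λ 1)) A *
            (fermionEmbed (PolySite.incl (subset_thicken Λ 1)) A)ᴴ)).re := by
  set At := fermionEmbed (PolySite.incl (subset_thicken Λ 1)) A with hAt
  set X₁ : FermionOp (thicken Λ 1) := Atᴴ *
      ((hubbardTTPrimeFermionInteraction t t' U).localHamiltonian (thicken Λ 1) * At -
        At * (hubbardTTPrimeFermionInteraction t t' U).localHamiltonian (thicken Λ 1)) with hX₁
  set X₂ : FermionOp (thicken Λ 1) := Atᴴ * At with hX₂
  set X₃ : FermionOp (thicken Λ 1) := At * Atᴴ with hX₃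
  have h₁ := (Complex.continuous_re.tendsto _).comp (hω (thicken Λ 1) X₁)
  have h₂ := (Complex.continuous_re.tendsto _).comp (hω (thicken Λ 1) X₂)
  have h₃ := (Complex.continuous_re.tendsto _).comp (hω' (thicken Λ 1) X₃)
  have hlim : Tendsto (fun j =>
      β * (∑ i, (p (Ls j) i : ℂ) * torusAvgExpect (Ls j) (thicken Λ 1) X₁ (ψ (Ls j) i)).re -
        s * (∑ i, (p (Ls j) i : ℂ) * torusAvgExpect (Ls j) (thicken Λ 1) X₂ (ψ (Ls j) i)).re +
        q * ((∑ d, Real.exp (-(β * sectorEigenvalue (P' (Ls j)) (hubbardTorusTT' (Ls j) t t' U)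
              (hubbardTorusTT'_isHermitian (Ls j) t t' U) d))) /
            ∑ c, Real.exp (-(β * sectorEigenvalue (P (Ls j)) (hubbardTorusTT' (Ls j) t t' U)
              (hubbardTorusTT'_isHermitian (Ls j) t t' U) c))) *
          (∑ i, (p' (Ls j) i : ℂ) * torusAvgExpect (Ls j) (thicken Λ 1) X₃ (ψ' (Ls j) i)).re)
      atTop (𝓝 (β * (ω.expect (thicken Λ 1) X₁).re - s * (ω.expect (thicken Λ 1) X₂).re +
        q * r * (ω'.expect (thicken Λ 1) X₃).re)) := by
    have h₃' := (hr.const_mul q).mul h₃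
    simp only [Function.comp_def] at h₁ h₂ h₃ h₃'
    exact ((h₁.const_mul β).sub (h₂.const_mul s)).add h₃'
  refine ge_of_tendsto hlim ?_
  filter_upwards [eventually_injOn_proj_of_tendsto (thicken (thicken Λ 1) 1) hLs, hLs.eventually_ge_atTop 1,
    hB, hB'] with j hInj hj hBj hB'j
  haveI : NeZero (Ls j) := ⟨by omega⟩
  have h₁' : Set.InjOn (Torus.proj (d := 2) (Ls j)) ↑(thicken Λ 1) :=
    hInj.mono (by exact_mod_cast subset_thicken (thicken Λ 1) 1)
  rw [sum_reindex_torusAvg' (e (Ls j)) _ _ (hp (Ls j)) (hψ (Ls j)) X₁,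
    sum_reindex_torusAvg' (e (Ls j)) _ _ (hp (Ls j)) (hψ (Ls j)) X₂,
    sum_reindex_torusAvg' (e' (Ls j)) _ _ (hp' (Ls j)) (hψ' (Ls j)) X₃]
  exact twoSector_eeb_torusAvgExpectAt_nonneg (Ls j) t t' U β (P (Ls j)) (P' (Ls j)) (hP (Ls j))
    (hP' (Ls j)) (hUP (Ls j)) (hUP' (Ls j)) h₁' hInj A (hBj inferInstance h₁') (hB'j inferInstance h₁') hq

end Eventually

/-! ### §2 The single annihilator `c_{x↑}`: its torus embedding lowers `N↑` by one -/

section Annihilator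

variable (L : ℕ) [NeZero L]

/-- The torus embedding of the local annihilator `c_{x↑} ∈ 𝔄_Λ` (through `𝔄_{Λ₁}`) is the torus
annihilator at the image site. [cite: ArakiMoriya2003, §4.1 Def. 4.3] -/
theorem fermionEmbed_toTorusEmb_incl_annihilation {Λ : Finset (Site 2)}
    (h₁ : Set.InjOn (Torus.proj (d := 2) L) ↑(thicken Λ 1)) {x : Site 2} (hx : x ∈ Λ) (σ : Fin 2) :
    fermionEmbed (PolySite.toTorusEmb L h₁)
        (fermionEmbed (PolySite.incl (subset_thicken Λ 1)) (annihilation (orb (PolySite.pt x hx) σ))) =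
      annihilation (orb (PolySite.toTorusEmb L h₁ (PolySite.incl (subset_thicken Λ 1) (PolySite.pt x hx))) σ) := by
  rw [fermionEmbed_annihilation, fermionEmbed_annihilation]

omit [NeZero L] in
/-- **`c_{y↑}` carries the sector `(rectN n L, S^z = 0) = (k, k)` into `(k − 1, k)`** (`k = halfRectN n L ≥ 1`).
[cite: LiebPRL1989, proof of Theorem 1] -/
theorem annihilation_up_mulVec_mem_szSector_pred {n : ℝ} (hk : 1 ≤ halfRectN n L) (y : FermionTorus 2 L)
    (w : Fock (Orb (FermionTorus 2 L))) (hw : w ∈ szSector (rectN n L) (0 : ℝ)) :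
    annihilation (orb y 0) *ᵥ w ∈
      szSector ((halfRectN n L - 1) + halfRectN n L) ((((halfRectN n L - 1 : ℕ) : ℝ) - halfRectN n L) / 2) := by
  rw [mem_szSector_iff_isInSector]
  have hw' : IsInSector (halfRectN n L - 1 + 1) (halfRectN n L) w := by
    rw [Nat.sub_add_cancel hk]
    exact (mem_szSector_rectN_iff n L w).1 hw
  exact hw'.annihilation_up_mulVec y

omit [NeZero L] in
/-- **`c†_{y↑}` carries the sector `(k − 1, k)` back into `(k, k) = (rectN n L, S^z = 0)`** (`k ≥ 1`).
[cite: LiebPRL1989, proof of Theorem 1] -/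
theorem creation_up_mulVec_mem_szSector_rectN {n : ℝ} (hk : 1 ≤ halfRectN n L) (y : FermionTorus 2 L)
    (w : Fock (Orb (FermionTorus 2 L)))
    (hw : w ∈ szSector ((halfRectN n L - 1) + halfRectN n L) ((((halfRectN n L - 1 : ℕ) : ℝ) - halfRectN n L) / 2)) :
    (annihilation (orb y 0))ᴴ *ᵥ w ∈ szSector (rectN n L) (0 : ℝ) := by
  rw [annihilation_conjTranspose, mem_szSector_rectN_iff]
  have hw' : IsInSector (halfRectN n L - 1) (halfRectN n L) w := (mem_szSector_iff_isInSector _ _ w).1 hw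
  have h := hw'.creation_up_mulVec y
  rw [Nat.sub_add_cancel hk] at h
  exact h

omit [NeZero L] in
/-- `k_L = halfRectN n L ≥ 1` as soon as `n·L ≥ 2` (`0 < n`, `1 ≤ L`). [folklore] -/
private theorem one_le_halfRectN_of_le {n : ℝ} (hn : 0 < n) (hL1 : 1 ≤ L) (hL : 2 ≤ n * L) :
    1 ≤ halfRectN n L := by
  unfold halfRectN
  rw [Nat.le_floor_iff (by positivity)]
  have hL' : (1 : ℝ) ≤ L := by exact_mod_cast hL1
  have : n * L ≤ n * (L : ℝ) ^ 2 := by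
    rw [sq]
    exact mul_le_mul_of_nonneg_left (le_mul_of_one_le_right (by positivity) hL') hn.le
  push_cast
  linarith

omit [NeZero L] in
/-- Along `Ls → ∞`, eventually `1 ≤ halfRectN n (Ls j)` for `0 < n`. [folklore] -/
private theorem eventually_one_le_halfRectN {n : ℝ} (hn : 0 < n) {Ls : ℕ → ℕ} (hLs : Tendsto Ls atTop atTop) :
    ∀ᶠ j in atTop, 1 ≤ halfRectN n (Ls j) := by
  filter_upwards [hLs.eventually_ge_atTop (⌈2 / n⌉₊ + 1)] with j hj
  refine one_le_halfRectN_of_le (Ls j) hn (by omega) ?_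
  have h1 : (⌈2 / n⌉₊ : ℝ) + 1 ≤ Ls j := by exact_mod_cast hj
  have h2 : 2 / n ≤ ⌈2 / n⌉₊ := Nat.le_ceil _
  have h3 : 2 / n ≤ (Ls j : ℝ) := by linarith
  have := mul_le_mul_of_nonneg_left h3 hn.le
  rwa [mul_div_cancel₀ _ hn.ne'] at this

end Annihilator

/-! ### §3 The «rm↑» row for the thermal object of record -/

section Record

variable (t t' U β : ℝ)

/-- **The two-sector row of the single annihilator `c_{x↑}` for the thermal object of record.** Let `ω`
be a torus limit of the canonical Gibbs states of `hubbardTorusTT' (Ls j) t t' U` at inverse temperature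
`β` on the sectors `(rectN n (Ls j), S^z = 0)` along `Ls → ∞` (`0 < n`), let `ω'` be a torus limit ALONG
THE SAME `Ls` of the canonical Gibbs states on the spin sectors `(k_L − 1, k_L)` (`k_L = halfRectN n L`;
the image of `c_{x↑}`), and `r = lim_j Z_{(k−1,k)}(Ls j)/Z_{(k,k)}(Ls j)` (the exponential of `β` times
the canonical removal cost of an up-electron). Then for `x ∈ Λ`, `c̃ = Γ_{Λ⊆Λ₁}c_{x↑}`, `Λ₁ = thicken Λ 1`,
and all real `s, q` with `e^{s−1} ≤ q`:
`0 ≤ β·Re ω_{Λ₁}(c̃†(H^{tt'U}_{Λ₁}c̃ − c̃H^{tt'U}_{Λ₁})) − s·Re ω_{Λ₁}(c̃†c̃) + q·r·Re ω'_{Λ₁}(c̃c̃†)` — the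
sector-mapping hypotheses of the general theorem DISCHARGED (`c` lowers, `c†` raises `N↑` by one).
[cite: FawziFawziScalet2024, Thm. 3.1] [cite: BratteliRobinsonII1997, §5.4.2]
[cite: LiebPRL1989, proof of Theorem 1] -/
theorem InfVolFermionState.IsTorusLimitOfMixture.re_expect_twoSector_eeb_annihilation_up_nonneg_of_sectorGibbs
    {n : ℝ} (hn : 0 < n) {Ls : ℕ → ℕ} (hLs : Tendsto Ls atTop atTop) {ω ω' : InfVolFermionState 2}
    (hω : ω.IsTorusLimitOfMixture (sectorGibbsCount n) (fun L => sectorGibbsWeightTT' β t t' U n L)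
      (fun L => sectorGibbsVectorTT' t t' U n L) Ls)
    (hω' : ω'.IsTorusLimitOfMixture
      (fun L => Fintype.card (Subtype (spinConfig (Λ := FermionTorus 2 L) (halfRectN n L - 1) (halfRectN n L))))
      (fun L i => canonicalWeight β (sectorEigenvalue (spinConfig (halfRectN n L - 1) (halfRectN n L))
        (hubbardTorusTT' L t t' U) (hubbardTorusTT'_isHermitian L t t' U)) ((Fintype.equivFin _).symm i))
      (fun L i => sectorEigenvector (spinConfig (halfRectN n L - 1) (halfRectN n L)) (hubbardTorusTT' L t t' U)
        (hubbardTorusTT'_isHermitian L t t' U) ((Fintype.equivFin _).symm i)) Ls)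
    {r : ℝ} (hr : Tendsto (fun j =>
      (∑ d, Real.exp (-(β * sectorEigenvalue (spinConfig (halfRectN n (Ls j) - 1) (halfRectN n (Ls j)))
          (hubbardTorusTT' (Ls j) t t' U) (hubbardTorusTT'_isHermitian (Ls j) t t' U) d))) /
        ∑ c, Real.exp (-(β * sectorEigenvalue (szConfig n (Ls j)) (hubbardTorusTT' (Ls j) t t' U)
          (hubbardTorusTT'_isHermitian (Ls j) t t' U) c))) atTop (𝓝 r))
    {Λ : Finset (Site 2)} {x : Site 2} (hx : x ∈ Λ) {s q : ℝ} (hq : Real.exp (s - 1) ≤ q) :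
    0 ≤ β * (ω.expect (thicken Λ 1)
          ((fermionEmbed (PolySite.incl (subset_thicken Λ 1)) (annihilation (orb (PolySite.pt x hx) 0)))ᴴ *
            ((hubbardTTPrimeFermionInteraction t t' U).localHamiltonian (thicken Λ 1) *
                fermionEmbed (PolySite.incl (subset_thicken Λ 1)) (annihilation (orb (PolySite.pt x hx) 0)) -
              fermionEmbed (PolySite.incl (subset_thicken Λ 1)) (annihilation (orb (PolySite.pt x hx) 0)) *
                (hubbardTTPrimeFermionInteraction t t' U).localHamiltonian (thicken Λ 1)))).re -
        s * (ω.expect (thicken Λ 1)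
          ((fermionEmbed (PolySite.incl (subset_thicken Λ 1)) (annihilation (orb (PolySite.pt x hx) 0)))ᴴ *
            fermionEmbed (PolySite.incl (subset_thicken Λ 1)) (annihilation (orb (PolySite.pt x hx) 0)))).re +
        q * r * (ω'.expect (thicken Λ 1)
          (fermionEmbed (PolySite.incl (subset_thicken Λ 1)) (annihilation (orb (PolySite.pt x hx) 0)) *
            (fermionEmbed (PolySite.incl (subset_thicken Λ 1)) (annihilation (orb (PolySite.pt x hx) 0)))ᴴ)).re := by
  -- the weights of record are the canonical weights, reindexed
  have hwrec : ∀ L (i : Fin (sectorGibbsCount n L)), sectorGibbsWeightTT' β t t' U n L i =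
      canonicalWeight β (sectorEigenvalue (szConfig n L) (hubbardTorusTT' L t t' U)
        (hubbardTorusTT'_isHermitian L t t' U)) (sectorGibbsIndex n L i) := by
    intro L i
    rw [sectorGibbsWeightTT', show sectorGibbsEnergyTT' t t' U n L =
      sectorEigenvalue (szConfig n L) (hubbardTorusTT' L t t' U) (hubbardTorusTT'_isHermitian L t t' U) ∘
        sectorGibbsIndex n L from rfl]
    unfold canonicalWeight
    rw [show (∑ b, Real.exp (-(β * (sectorEigenvalue (szConfig n L) (hubbardTorusTT' L t t' U)
        (hubbardTorusTT'_isHermitian L t t' U) ∘ sectorGibbsIndex n L) b))) =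
      ∑ b, Real.exp (-(β * sectorEigenvalue (szConfig n L) (hubbardTorusTT' L t t' U)
        (hubbardTorusTT'_isHermitian L t t' U) b)) from
      Equiv.sum_comp (sectorGibbsIndex n L) (fun b => Real.exp (-(β * sectorEigenvalue (szConfig n L)
        (hubbardTorusTT' L t t' U) (hubbardTorusTT'_isHermitian L t t' U) b)))]
    rfl
  refine InfVolFermionState.re_expect_twoSector_eeb_nonneg_of_canonical_limits_eventually t t' U β
    (fun L => szConfig n L) (fun L => spinConfig (Λ := FermionTorus 2 L) (halfRectN n L - 1) (halfRectN n L))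
    (fun L s s' hs hs' => hubbardTorusTT'_apply_eq_zero_of_szConfig L t t' U n s s' hs hs')
    (fun L s s' hs hs' => hubbardTorusTT'_apply_eq_zero_of_spinConfig L t t' U _ _ s s' hs hs')
    (fun L _ v s s' hs hs' => fockTranslate_apply_eq_zero_of_szConfig L v n s s' hs hs')
    (fun L _ v s s' hs hs' => fockTranslate_apply_eq_zero_of_spinConfig L v _ _ s s' hs hs')
    (fun L => sectorGibbsIndex n L) (fun L => (Fintype.equivFin _).symm)
    hwrec (fun L i => rfl) (fun L i => rfl) (fun L i => rfl) hLs hω hω' hr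
    (annihilation (orb (PolySite.pt x hx) 0)) ?_ ?_ hq
  · filter_upwards [eventually_one_le_halfRectN hn hLs] with j hk hL h₁ s s' hs hs'
    rw [fermionEmbed_toTorusEmb_incl_annihilation]
    exact apply_eq_zero_off_of_mulVec_mem₂ (szConfig n (Ls j)) (spinConfig _ _)
      (szSector (rectN n (Ls j)) 0) (szSector _ _) (mem_szSector_rectN_iff n (Ls j))
      (mem_szSector_iff_spinConfig (Ls j) _ _)
      (fun w hw => annihilation_up_mulVec_mem_szSector_pred (Ls j) hk _ w hw) s s' hs hs'
  · filter_upwards [eventually_one_le_halfRectN hn hLs] with j hk hL h₁ s s' hs hs'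
    rw [fermionEmbed_toTorusEmb_incl_annihilation]
    exact apply_eq_zero_off_of_mulVec_mem₂ (spinConfig _ _) (szConfig n (Ls j))
      (szSector _ _) (szSector (rectN n (Ls j)) 0) (mem_szSector_iff_spinConfig (Ls j) _ _)
      (mem_szSector_rectN_iff n (Ls j))
      (fun w hw => creation_up_mulVec_mem_szSector_rectN (Ls j) hk _ w hw) s s' hs hs'

end Record

end Literature.MathematicalPhysics.QuantumLattice

end
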